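import Summits.QuantumFields.GaugeBoot.TiltedBoxTwoDimMidAnnulus
import Summits.QuantumFields.GaugeBoot.TiltedLatticeMidReflection
import HarnessLib

/-!
# Link-mirror RP of the even square tilted box in two dimensions: the split and the frozen factors (gauge-boot, L3 supplement: 2D slab gluing, even side 3a/3)

HONEST FRAMING (cell `pub-gaugeboot`, page 1 of every file): the venture produces certified bounds
on lattice expectations at stated coupling, gauge group, dimension and torus size; NOT a mass gap,
NOT a continuum limit, NOT a string tension; NOT Yang–Mills-summit-bearing (barriers
`FixedCouplingUltralocality`, `PerturbativeInvisibility`). Bookkeeping for the POSITIVE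
two-dimensional result `TiltedBoxEvenMidAxisRPTwoDim.lean` (even-side twin of
`TiltedBoxOddAxisRPTwoDim.lean`); it discharges nothing else.

Setting: the even square box `ℤ^d/Γ(2P, 2P, L)`, `P ≥ 2`, two dimensions (`∀ k, k = i ∨ k = j`), the
LINK mirror `Θ = configMidReflect` of the flip `x_i ↦ -x_i` (`x_i ↦ 1 - x_i` on sites), the closed half
`{1 ≤ x_i ≤ P}`. Contents: `Θ` preserves the product Haar measure (`configMidReflect = configReflect ∘ τ_{e_i}`);
the half observable `gMid = F e^{-β E}` (`E = midExpo` of `TiltedBoxEvenMidAxisWitness.lean`) and the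
integrand `hMid = gMid · conj(gMid ∘ Θ)`; the SPLIT of the Boltzmann weight into `hMid` and the TWO annulus
products of plaquette weights (lower slab `0|1`, upper slab `P|P+1`; `midExpo_configMidReflect_add`);
`hMid` and the annulus words are blind to the rungs; the slab kernel is continuous and symmetric.

References: A. A. Migdal, Sov. Phys. JETP 42 (1975) 413; K. Osterwalder, E. Seiler, Ann. Phys. 110
(1978) 440, §2; J. Fröhlich, R. Israel, E. H. Lieb, B. Simon, J. Stat. Phys. 22 (1980) 297, §3.
-/

noncomputable section

open MeasureTheory Complex Function
open scoped ComplexOrder ComplexConjugate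
open Literature.MathematicalPhysics.QuantumLattice (haarConv)
open Literature.MathematicalPhysics.QuantumFieldTheory (haarProbability)
open Literature.RepresentationTheory.CompactGroups

namespace Summit.QuantumFields.GaugeBoot

/-! ## The slab kernel is continuous and symmetric -/

namespace SlabKernel

variable {G : Type*} [Group G] [TopologicalSpace G] [IsTopologicalGroup G] [CompactSpace G]
  [MeasurableSpace G] [BorelSpace G] [SecondCountableTopology G]

/-- The slab kernel is jointly continuous (continuous `ψ`). [folklore] -/
theorem continuous_uncurry_slabKernel {ψ : G → ℝ} (hψ : Continuous ψ) : Continuous (uncurry (slabKernel ψ)) := by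
  have hc : Continuous (haarConv ψ ψ) :=
    Literature.MathematicalPhysics.QuantumLattice.continuous_haarConv hψ
      (hψ.integrable_of_hasCompactSupport (HasCompactSupport.of_compactSpace _))
  have hF : Continuous (uncurry fun (p : G × G) (x : G) => haarConv ψ ψ (p.1 * x * p.2⁻¹ * x⁻¹)) :=
    hc.comp ((((continuous_fst.comp continuous_fst).mul continuous_snd).mul
      (continuous_snd.comp continuous_fst).inv).mul continuous_snd.inv)
  exact continuous_integral_of_continuous hF

/-- The slab kernel is symmetric: `k(α, β) = k(β, α)` (`ψ` continuous, central, symmetric). [folklore] -/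
theorem slabKernel_symm {ψ : G → ℝ} (hψc : Continuous ψ) (hψ : ∀ g h, ψ (h * g * h⁻¹) = ψ g)
    (hψi : ∀ g, ψ g⁻¹ = ψ g) (α β : G) : slabKernel ψ α β = slabKernel ψ β α := by
  rw [slabKernel_eq_integral_featureMap hψc hψ hψi, slabKernel_eq_integral_featureMap hψc hψ hψi]
  exact integral_congr_ae (ae_of_all _ fun u => mul_comm _ _)

end SlabKernel

namespace TiltedRP

namespace TwoDim

variable {d : ℕ} {i j : Fin d} {L P N : ℕ} [NeZero L] [NeZero P]
variable {G : Type*} [Group G] [TopologicalSpace G] [IsTopologicalGroup G] [CompactSpace G]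
  [MeasurableSpace G] [BorelSpace G] [SecondCountableTopology G]
variable (ρ : G →* Matrix (Fin N) (Fin N) ℂ)

/-! ## The link mirror preserves the product Haar measure -/

omit [SecondCountableTopology G] in
/-- **`Θ_mid` preserves the product Haar measure** (`Θ_mid = Θ_site ∘ τ_{e_i}`). [folklore] -/
theorem measurePreserving_configMidReflect_flip (hij : i ≠ j) :
    MeasurePreserving (configMidReflect (G := G) (tiltedUnit d i j (2 * P) (2 * P) L) i (tiltedAxisFlip d L (2 * P) hij))
      (productHaar (TiltedSite d i j (2 * P) (2 * P) L) d G) (productHaar (TiltedSite d i j (2 * P) (2 * P) L) d G) := by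
  have he : configMidReflect (G := G) (tiltedUnit d i j (2 * P) (2 * P) L) i (tiltedAxisFlip d L (2 * P) hij) =
      configReflect (tiltedUnit d i j (2 * P) (2 * P) L) i (tiltedAxisFlip d L (2 * P) hij) ∘
        translate (tiltedUnit d i j (2 * P) (2 * P) L i) :=
    funext fun U => configMidReflect_eq_configReflect_translate _ i _ U
  rw [he]
  exact ((isAxisFlip_tiltedAxisFlip d L (2 * P) hij).measurePreserving_configReflect (G := G)).comp
    (measurePreserving_translate _)

omit [NeZero L] [NeZero P] [CompactSpace G] [MeasurableSpace G] [BorelSpace G] [SecondCountableTopology G] in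
/-- `Θ_mid` is continuous (a relabelling of the links composed with inversions). [folklore] -/
theorem continuous_configMidReflect_flip (hij : i ≠ j) :
    Continuous (configMidReflect (G := G) (tiltedUnit d i j (2 * P) (2 * P) L) i (tiltedAxisFlip d L (2 * P) hij)) := by
  refine continuous_pi fun l => ?_
  unfold configMidReflect
  split_ifs
  · exact (continuous_apply _).inv
  · exact continuous_apply _

/-! ## The half observable and the integrand -/

/-- The half-weighted observable `g = F · e^{-β E}` (`E = midExpo`). -/
def gMid (β : ℝ) (F : Config (TiltedSite d i j (2 * P) (2 * P) L) d G → ℂ)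
    (U : Config (TiltedSite d i j (2 * P) (2 * P) L) d G) : ℂ :=
  F U * (Real.exp (-β * midExpo ρ U) : ℂ)

/-- The integrand after the split: `h = g · conj(g ∘ Θ_mid)`. -/
def hMid (β : ℝ) (F : Config (TiltedSite d i j (2 * P) (2 * P) L) d G → ℂ) (hij : i ≠ j)
    (U : Config (TiltedSite d i j (2 * P) (2 * P) L) d G) : ℂ :=
  gMid ρ β F U * conj (gMid ρ β F (configMidReflect (tiltedUnit d i j (2 * P) (2 * P) L) i
    (tiltedAxisFlip d L (2 * P) hij) U))

omit [TopologicalSpace G] [IsTopologicalGroup G] [CompactSpace G] [MeasurableSpace G] [BorelSpace G]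
  [SecondCountableTopology G] in
/-- `E = midExpo` depends only on the positive links. [folklore] -/
theorem midExpo_eq_of_posLinks (hP : 2 ≤ P) {U V : Config (TiltedSite d i j (2 * P) (2 * P) L) d G}
    (hUV : ∀ l, IsMidPosLink (tiltedUnit d i j (2 * P) (2 * P) L) P (axisCoord d L (2 * P)) l → U l = V l) :
    midExpo ρ U = midExpo ρ V := by
  unfold midExpo
  refine Finset.sum_congr rfl fun p _ => ?_
  by_cases hp : midWeight p = 0
  · rw [hp, zero_mul, zero_mul]
  · rw [plaqObs_eq_of_midWeight_ne_zero ρ hP hUV hp]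

omit [TopologicalSpace G] [IsTopologicalGroup G] [CompactSpace G] [MeasurableSpace G] [BorelSpace G]
  [SecondCountableTopology G] in
/-- `g` is an observable of the closed half `{1 ≤ x_i ≤ P}`. [folklore] -/
theorem gMid_eq_of_posLinks (hP : 2 ≤ P) (β : ℝ) {F : Config (TiltedSite d i j (2 * P) (2 * P) L) d G → ℂ}
    (hFo : IsMidObservable (tiltedUnit d i j (2 * P) (2 * P) L) P (axisCoord d L (2 * P)) F)
    {U V : Config (TiltedSite d i j (2 * P) (2 * P) L) d G}
    (hUV : ∀ l, IsMidPosLink (tiltedUnit d i j (2 * P) (2 * P) L) P (axisCoord d L (2 * P)) l → U l = V l) :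
    gMid ρ β F U = gMid ρ β F V := by
  unfold gMid
  rw [hFo U V hUV, midExpo_eq_of_posLinks ρ hP hUV]

/-- `g` is measurable and bounded. [folklore] -/
theorem measurable_gMid_and_bound (hρ : Continuous ρ) (β : ℝ)
    {F : Config (TiltedSite d i j (2 * P) (2 * P) L) d G → ℂ} (hFm : Measurable F) {CF : ℝ}
    (hFb : ∀ U, ‖F U‖ ≤ CF) :
    Measurable (gMid ρ β F) ∧ ∃ Cg : ℝ, ∀ U, ‖gMid ρ β F U‖ ≤ Cg := by
  obtain ⟨CE, hCE⟩ := (isCompact_univ (X := Config (TiltedSite d i j (2 * P) (2 * P) L) d G)).exists_bound_of_continuousOn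
    (continuous_midExpo (L := L) (P := P) ρ hρ).continuousOn
  refine ⟨hFm.mul (Complex.measurable_ofReal.comp
    ((Real.continuous_exp.comp (continuous_const.mul (continuous_midExpo ρ hρ))).measurable)),
    CF * Real.exp (|β| * CE), fun U => ?_⟩
  rw [gMid, norm_mul, Complex.norm_real, Real.norm_eq_abs, abs_of_pos (Real.exp_pos _)]
  refine mul_le_mul (hFb U) (Real.exp_le_exp.2 ?_) (Real.exp_pos _).le ((norm_nonneg _).trans (hFb U))
  calc -β * midExpo ρ U ≤ |-β * midExpo ρ U| := le_abs_self _
    _ = |β| * |midExpo ρ U| := by rw [abs_mul, abs_neg]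
    _ ≤ |β| * CE := mul_le_mul_of_nonneg_left (by simpa using hCE U (Set.mem_univ _)) (abs_nonneg _)

/-- `h` is measurable and bounded. [folklore] -/
theorem measurable_hMid_and_bound (hij : i ≠ j) (hρ : Continuous ρ) (β : ℝ)
    {F : Config (TiltedSite d i j (2 * P) (2 * P) L) d G → ℂ} (hFm : Measurable F) {CF : ℝ}
    (hFb : ∀ U, ‖F U‖ ≤ CF) :
    Measurable (hMid ρ β F hij) ∧ ∃ Ch : ℝ, ∀ U, ‖hMid ρ β F hij U‖ ≤ Ch := by
  obtain ⟨hgm, Cg, hgb⟩ := measurable_gMid_and_bound ρ hρ β hFm hFb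
  have hΘm := (measurePreserving_configMidReflect_flip (L := L) (P := P) (G := G) hij).measurable
  refine ⟨hgm.mul (Complex.continuous_conj.measurable.comp (hgm.comp hΘm)), Cg * Cg, fun U => ?_⟩
  rw [hMid, norm_mul, Complex.norm_conj]
  exact mul_le_mul (hgb U) (hgb _) (norm_nonneg _) ((norm_nonneg _).trans (hgb U))

omit [TopologicalSpace G] [IsTopologicalGroup G] [CompactSpace G] [MeasurableSpace G] [BorelSpace G]
  [SecondCountableTopology G] in
/-- `h` does not see the rungs of the two slabs. [folklore] -/
theorem hMid_update_rung [DecidableEq (TiltedSite d i j (2 * P) (2 * P) L)] (hP : 2 ≤ P) (hij : i ≠ j)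
    (hd : ∀ k : Fin d, k = i ∨ k = j) (β : ℝ) {F : Config (TiltedSite d i j (2 * P) (2 * P) L) d G → ℂ}
    (hFo : IsMidObservable (tiltedUnit d i j (2 * P) (2 * P) L) P (axisCoord d L (2 * P)) F)
    {y : TiltedSite d i j (2 * P) (2 * P) L}
    (hy : axisCoord d L (2 * P) y = 0 ∨ axisCoord d L (2 * P) y = ((P : ℕ) : ZMod (2 * P))) (s : ℕ)
    (U : Config (TiltedSite d i j (2 * P) (2 * P) L) d G) (z : G) :
    hMid ρ β F hij (update U (rungAt y s) z) = hMid ρ β F hij U := by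
  unfold hMid rungAt
  congr 1
  · exact gMid_eq_of_posLinks ρ hP β hFo fun l hl => posLinks_update_rung hP hij U hy s z l hl
  · congr 1
    exact gMid_eq_of_posLinks ρ hP β hFo fun l hl => configMidReflect_update_rung hP hij hd U hy s z l hl

/-! ## The split of the Boltzmann weight -/

omit [MeasurableSpace G] [BorelSpace G] [SecondCountableTopology G] in
open scoped Classical in
/-- **The split of the Boltzmann weight of the link mirror**:
`e^{-βS(U)} conj F(ΘU) F(U) = e^{-βN·2M}·e^{-βN·2M} · h(U) · ∏_{lower} plaqWt · ∏_{upper} plaqWt`,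
`M = 2P`. [folklore] -/
theorem boltzmann_split_mid (hP : 2 ≤ P) (hij : i ≠ j) (hd : ∀ k : Fin d, k = i ∨ k = j) (hρ : Continuous ρ)
    (β : ℝ) (F : Config (TiltedSite d i j (2 * P) (2 * P) L) d G → ℂ)
    (U : Config (TiltedSite d i j (2 * P) (2 * P) L) d G) :
    (Real.exp (-β * wilsonAction ρ (tiltedUnit d i j (2 * P) (2 * P) L) U) : ℂ) *
      (conj (F (configMidReflect (tiltedUnit d i j (2 * P) (2 * P) L) i (tiltedAxisFlip d L (2 * P) hij) U)) * F U) =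
      ((Real.exp (-β * N * (2 * (2 * P))) : ℂ) * (Real.exp (-β * N * (2 * (2 * P))) : ℂ)) *
        (hMid ρ β F hij U *
          (∏ t ∈ Finset.range (2 * (2 * P)), SlabKernel.plaqWt (SlabKernel.wilsonWt ρ β)
              (rungAt (layerSite d L P)) (loAt (layerSite d L P)) (upAt (layerSite d L P)) t U) *
          ∏ t ∈ Finset.range (2 * (2 * P)), SlabKernel.plaqWt (SlabKernel.wilsonWt ρ β)
              (rungAt (0 : TiltedSite d i j (2 * P) (2 * P) L)) (loAt 0) (upAt 0) t U) := by
  have hE := midExpo_configMidReflect_add (L := L) ρ hP hij hρ U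
  -- the two slabs are disjoint plaquette sets
  have hne : (0 : ZMod (2 * P)) ≠ ((P : ℕ) : ZMod (2 * P)) := by
    intro h
    have := congrArg ZMod.val h
    rw [ZMod.val_zero, ZMod.val_natCast, Nat.mod_eq_of_lt (by omega)] at this
    omega
  have hdisj : Disjoint (Finset.univ.filter (SquareSlab.IsSlabPlaq (L := L) (i := i) (j := j) (0 : ZMod (2 * P))))
      (Finset.univ.filter (SquareSlab.IsSlabPlaq ((P : ℕ) : ZMod (2 * P)))) := by
    rw [Finset.disjoint_filter]
    intro p _ h0 hP'
    exact hne (h0.2.symm.trans hP'.2)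
  have hsum : ∑ p ∈ Finset.univ.filter (fun p => SquareSlab.IsSlabPlaq (0 : ZMod (2 * P)) p ∨
        SquareSlab.IsSlabPlaq ((P : ℕ) : ZMod (2 * P)) p),
        ((N : ℝ) - plaqObs ρ (tiltedUnit d i j (2 * P) (2 * P) L) p U) =
      (∑ p ∈ Finset.univ.filter (SquareSlab.IsSlabPlaq (axisCoord d L (2 * P) (layerSite d L P : TiltedSite d i j (2 * P) (2 * P) L))),
          ((N : ℝ) - plaqObs ρ (tiltedUnit d i j (2 * P) (2 * P) L) p U)) +
        ∑ p ∈ Finset.univ.filter (SquareSlab.IsSlabPlaq (axisCoord d L (2 * P) (0 : TiltedSite d i j (2 * P) (2 * P) L))),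
          ((N : ℝ) - plaqObs ρ (tiltedUnit d i j (2 * P) (2 * P) L) p U) := by
    rw [Finset.filter_or, Finset.sum_union hdisj, map_zero, axisCoord_layerSite, add_comm]
  have hS : -β * wilsonAction ρ (tiltedUnit d i j (2 * P) (2 * P) L) U =
      -β * midExpo ρ U + -β * midExpo ρ (configMidReflect (tiltedUnit d i j (2 * P) (2 * P) L) i
        (tiltedAxisFlip d L (2 * P) hij) U) +
      (-β * ∑ p ∈ Finset.univ.filter (SquareSlab.IsSlabPlaq (axisCoord d L (2 * P) (layerSite d L P : TiltedSite d i j (2 * P) (2 * P) L))),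
          ((N : ℝ) - plaqObs ρ (tiltedUnit d i j (2 * P) (2 * P) L) p U) +
        -β * ∑ p ∈ Finset.univ.filter (SquareSlab.IsSlabPlaq (axisCoord d L (2 * P) (0 : TiltedSite d i j (2 * P) (2 * P) L))),
          ((N : ℝ) - plaqObs ρ (tiltedUnit d i j (2 * P) (2 * P) L) p U)) := by
    rw [hsum] at hE
    linear_combination β * hE
  rw [hS, Real.exp_add, Real.exp_add, Real.exp_add, Complex.ofReal_mul, Complex.ofReal_mul, Complex.ofReal_mul,
    exp_slabSq_eq ρ hij hd hρ β _ U, exp_slabSq_eq ρ hij hd hρ β _ U, hMid, gMid, gMid, map_mul, Complex.conj_ofReal]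
  push_cast
  ring

end TwoDim

end TiltedRP

end Summit.QuantumFields.GaugeBoot

end
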